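import Summits.Ventures.YMGap.RobustBall.Targets
import Summits.Ventures.YMGap.RobustBall.ClassFunctionTerm
import Summits.Ventures.YMGap.RobustBall.PlaquetteCode
import HarnessLib

/-!
# Venture YMGap — ROBUST-BALL (Y2): the plaquette rung INSIDE the ball — `PlaquetteMemberTargetC N d` for `N ≥ 2`
# (every continuous class-function plaquette action is a tier-1 member with the typed site-incidence loads)

HONEST FRAMING: venture file (cell `pub-ymgap`, seat ds-4), lattice bookkeeping on the finite torus `(ℤ/L)^d`;
nothing about the continuum or a Clay-sense mass gap.  A MEMBERSHIP certificate (the T0.6 «sub-ball honesty» of the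
plaquette rung): for every continuous class function `f` on `SU(N)` with `f x − f y ≤ a₀` and
`|f x − f y| ≤ λ ‖x − y‖_F`, and every torus `L ≥ 3`, the plaquette action `W_f = Σ_q f(U_q)` is built INSIDE
rb-theory's carrier with `IsPlaquetteAction f W_f`, `IsPlaquetteLocal W_f`,
`W_f ∈ ClusterDomainFR (2(d−1)a₀) (6d(d−1)λ) 1`, `HasVertRange 1 W_f`, `IsSlabLocal 1 W_f` — the typed target
`RobustBall.Targets.PlaquetteMemberTargetC N d` (landed SITE-incidence numbers), proved for every `N ≥ 2` and every `d`.

WHY `N ≥ 2`: the target quantifies `λ` over all reals; for `N ≥ 2` the Lipschitz hypothesis at the two points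
`e^{2πi/N}·1 ≠ 1` of `SU(N)` forces `λ ≥ 0` (`lipschitz_const_nonneg`).  For `N ≤ 1` the group `SU(N)` is a point, the
hypothesis is idle, a negative `λ` is admitted, and the load budget `6d(d−1)λ < 0` (`d ≥ 2`) cannot bound the
(nonnegative) Lipschitz loads of any witness: AS TYPED the target is false at `N ≤ 1 ∧ d ≥ 2` (e.g. `N = 1, d = 2,
f = 0, a₀ = 0, λ = −1`); the physical range `N ≥ 2` is unaffected.

CONSTRUCTION (on p1's `TermPerturbation`): one `LocalTerm.ofClass` per plaquette `q = (x; i < j)` — activity `f(U_q)`,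
letters = the plaquette word, polymer = `plaqCode` — assembled by `termPerturbation`.  COUNTS: every link carries
`2(d−1)` plaquette letters (⇒ oscillation load `2(d−1)a₀`); a site lies in the polymer of `≤ 3` based plaquettes per
direction pair, `C(d,2)` pairs, `4λ` per plaquette ⇒ site-incidence Lipschitz load `≤ 6d(d−1)λ`; polymer diameter `1`;
vertical window `1`; balanced words ⇒ centre-slab invariance; `L ≥ 3` ⇒ injective code ⇒ plaquette locality.
-/

noncomputable section

open MeasureTheory Finset Function
open Literature.Probability.LatticeModels Literature.Probability.LatticeModels.DobrushinMetric
open Literature.MathematicalPhysics.QuantumLattice hiding torusNorm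
open Literature.MathematicalPhysics.QuantumFieldTheory hiding ZdEdge

namespace Summit.Ventures.YMGap.RobustBall

variable {d L N : ℕ}

/-! ### The plaquette family and its counts -/

section Family

variable (f : SUN N → ℝ) (a₀ lam : ℝ) (hf : Continuous f) (hfconj : ∀ g h : SUN N, f (h * g * h⁻¹) = f g)
  (hfosc : ∀ x y, f x - f y ≤ a₀) (hlam : 0 ≤ lam) (hflip : ∀ x y, |f x - f y| ≤ lam * suFrobDist x y)

variable (d L) in
/-- The family of class-function terms of all plaquettes `q = (x; i < j)`, each on its own polymer `plaqCode`.
[folklore] -/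
def plaqFamily (q : Plaquette d L) : LocalTerm d L N :=
  LocalTerm.ofClass f a₀ lam hf hfconj hfosc hlam hflip (plaqWord q.1 q.2.1.1 q.2.1.2) (plaqCode q.1 q.2.1.1 q.2.1.2)
    q.1 (isWalk_plaqWord q.1 q.2.1.1 q.2.1.2) fun _ hl => site_mem_plaqCode hl

/-- The activity of a plaquette term is `f(U_q)` with the tree's plaquette holonomy. [folklore] -/
theorem plaqFamily_act (q : Plaquette d L) (U : GaugeConfig d L (SUN N)) :
    (plaqFamily d L f a₀ lam hf hfconj hfosc hlam hflip q).act U = f (plaquetteHolonomy U q.1 q.2.1.1 q.2.1.2) :=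
  congrArg f (wordProd_plaqWord U q.1 q.2.1.1 q.2.1.2)

/-- The letters of a plaquette term. [folklore] -/
@[simp] theorem plaqFamily_letters (q : Plaquette d L) :
    (plaqFamily d L f a₀ lam hf hfconj hfosc hlam hflip q).letters = plaqWord q.1 q.2.1.1 q.2.1.2 := rfl

/-- The polymer of a plaquette term. [folklore] -/
@[simp] theorem plaqFamily_code (q : Plaquette d L) :
    (plaqFamily d L f a₀ lam hf hfconj hfosc hlam hflip q).code = plaqCode q.1 q.2.1.1 q.2.1.2 := rfl

/-- The oscillation constant of a plaquette term. [folklore] -/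
@[simp] theorem plaqFamily_oscC (q : Plaquette d L) :
    (plaqFamily d L f a₀ lam hf hfconj hfosc hlam hflip q).oscC = a₀ := rfl

/-- The Lipschitz constant of a plaquette term. [folklore] -/
@[simp] theorem plaqFamily_lipC (q : Plaquette d L) :
    (plaqFamily d L f a₀ lam hf hfconj hfosc hlam hflip q).lipC = lam := rfl

/-- For `3 ≤ L` distinct plaquettes have distinct polymers. [folklore] -/
theorem plaqFamily_code_injective (hL : 3 ≤ L) :
    Function.Injective fun q => (plaqFamily d L f a₀ lam hf hfconj hfosc hlam hflip q).code := by
  rintro ⟨x, ⟨i, j⟩, hij⟩ ⟨x', ⟨i', j'⟩, hij'⟩ h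
  obtain ⟨rfl, rfl, rfl⟩ := plaqCode_injective hL hij hij' h
  rfl

variable [NeZero L]

/-- **The letter count through a link**: `Σ_q mult_{w_q}(e) = 2(d − 1)` (per direction pair through `e.2`, one
plaquette shows `e` as an `i`-letter pair member and one as a `j`-letter: two letters on `e` in total per pair,
`d − 1` pairs). [folklore] -/
theorem sum_mult_plaqFamily (e : Edge d L) :
    ∑ q : Plaquette d L, mult (plaqWord q.1 q.2.1.1 q.2.1.2) e = 2 * (d - 1) := by
  have h := sum_ltPair_ite_eq (d := d) e.2
  have hx : ∀ p : LtPair d, ∑ x : Site d L, mult (plaqWord x p.1.1 p.1.2) e =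
      2 * ((if p.1.1 = e.2 then 1 else 0) + (if p.1.2 = e.2 then 1 else 0)) := fun p => by
    rw [sum_mult_plaqWord]
    ring
  rw [Fintype.sum_prod_type_right]
  simp only [hx, ← mul_sum, h]

/-- The letter count through a link, over `ℝ`. [folklore] -/
theorem sum_mult_plaqFamily_real (e : Edge d L) :
    ∑ q : Plaquette d L, (mult (plaqWord q.1 q.2.1.1 q.2.1.2) e : ℝ) = 2 * ((d : ℝ) - 1) := by
  have hd : 1 ≤ d := Nat.succ_le_of_lt (Fin.pos e.2)
  have h := sum_mult_plaqFamily e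
  have h' : ((∑ q : Plaquette d L, mult (plaqWord q.1 q.2.1.1 q.2.1.2) e : ℕ) : ℝ) = ((2 * (d - 1) : ℕ) : ℝ) := by
    rw [h]
  push_cast [Nat.cast_sub hd] at h'
  exact h'

/-- At most three base points `x` put a given site into the plaquette polymer `plaqCode x i j`. [folklore] -/
theorem card_filter_mem_plaqCode_le (y : Site d L) (i j : Fin d) :
    (univ.filter fun x : Site d L => y ∈ plaqCode x i j).card ≤ 3 := by
  have hsub : (univ.filter fun x : Site d L => y ∈ plaqCode x i j) ⊆ {y, y - unitVec i, y - unitVec j} := by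
    intro x hx
    simp only [mem_filter, mem_univ, true_and, plaqCode, mem_insert, mem_singleton] at hx
    simp only [mem_insert, mem_singleton]
    rcases hx with rfl | rfl | rfl
    · exact Or.inl rfl
    · exact Or.inr (Or.inl (by abel))
    · exact Or.inr (Or.inr (by abel))
  refine (card_le_card hsub).trans ?_
  refine (card_insert_le _ _).trans (Nat.succ_le_succ ((card_insert_le _ _).trans (Nat.succ_le_succ ?_)))
  simp

/-- **The site count** (landed, site-based incidence): the Lipschitz mass of all plaquettes whose polymer contains the
base site of `e`: `Σ_{q : e.1 ∈ code q} λ·|w_q| ≤ λ · 4 · 3 · C(d,2) = 6 d (d − 1) λ`. [folklore] -/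
theorem sum_site_plaqFamily_le (e : Edge d L) :
    ∑ q, (if e.1 ∈ (plaqFamily d L f a₀ lam hf hfconj hfosc hlam hflip q).code then
        (plaqFamily d L f a₀ lam hf hfconj hfosc hlam hflip q).lipC *
          ((plaqFamily d L f a₀ lam hf hfconj hfosc hlam hflip q).letters.length : ℝ) else 0) ≤
      6 * (d : ℝ) * ((d : ℝ) - 1) * lam := by
  have hd : 1 ≤ d := Nat.succ_le_of_lt (Fin.pos e.2)
  have hinner : ∀ p : LtPair d,
      ∑ x : Site d L, (if e.1 ∈ plaqCode x p.1.1 p.1.2 then lam * (4 : ℝ) else 0) ≤ 12 * lam := by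
    intro p
    rw [← sum_filter, sum_const, nsmul_eq_mul]
    have := card_filter_mem_plaqCode_le (e.1) p.1.1 p.1.2
    have : ((univ.filter fun x : Site d L => e.1 ∈ plaqCode x p.1.1 p.1.2).card : ℝ) ≤ 3 := by exact_mod_cast this
    nlinarith
  have hcard : (Fintype.card (LtPair d) : ℝ) * 2 = (d : ℝ) * ((d : ℝ) - 1) := by
    have h := two_mul_card_ltPair (d := d)
    have h' : ((2 * Fintype.card (LtPair d) : ℕ) : ℝ) = ((d * (d - 1) : ℕ) : ℝ) := by rw [h]
    push_cast [Nat.cast_sub hd] at h'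
    linarith
  calc ∑ q, (if e.1 ∈ (plaqFamily d L f a₀ lam hf hfconj hfosc hlam hflip q).code then
          (plaqFamily d L f a₀ lam hf hfconj hfosc hlam hflip q).lipC *
            ((plaqFamily d L f a₀ lam hf hfconj hfosc hlam hflip q).letters.length : ℝ) else 0)
      = ∑ p : LtPair d, ∑ x : Site d L, (if e.1 ∈ plaqCode x p.1.1 p.1.2 then lam * (4 : ℝ) else 0) := by
        rw [Fintype.sum_prod_type_right]
        simp only [plaqFamily_code, plaqFamily_lipC, plaqFamily_letters, length_plaqWord, Nat.cast_ofNat]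
    _ ≤ ∑ _p : LtPair d, 12 * lam := sum_le_sum fun p _ => hinner p
    _ = 6 * (d : ℝ) * ((d : ℝ) - 1) * lam := by
        rw [sum_const, card_univ, nsmul_eq_mul]
        linear_combination (6 * lam) * hcard

end Family

/-! ### The member -/

section Member

variable [NeZero L] (f : SUN N → ℝ) (a₀ lam : ℝ) (hf : Continuous f)
  (hfconj : ∀ g h : SUN N, f (h * g * h⁻¹) = f g) (hfosc : ∀ x y, f x - f y ≤ a₀) (hlam : 0 ≤ lam)
  (hflip : ∀ x y, |f x - f y| ≤ lam * suFrobDist x y)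

/-- **Total** of the plaquette member: the plaquette action `Σ_q f(U_q)` — `IsPlaquetteAction f W_f`. [folklore] -/
theorem isPlaquetteAction_plaqFamily :
    IsPlaquetteAction f (termPerturbation (plaqFamily d L f a₀ lam hf hfconj hfosc hlam hflip)) := fun U => by
  rw [total_termPerturbation]
  exact sum_congr rfl fun q _ => plaqFamily_act f a₀ lam hf hfconj hfosc hlam hflip q U

/-- **Plaquette locality** of the member (`3 ≤ L`): an active polymer is the code of exactly one plaquette `q`, and
its activity `f(U_q)` reads only the four links of `q`. [folklore] -/
theorem isPlaquetteLocal_plaqFamily (hL : 3 ≤ L) :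
    IsPlaquetteLocal (termPerturbation (plaqFamily d L f a₀ lam hf hfconj hfosc hlam hflip)) := by
  intro X hX
  by_cases hfib : ∃ q, (plaqFamily d L f a₀ lam hf hfconj hfosc hlam hflip q).code = X
  · obtain ⟨q, rfl⟩ := hfib
    refine ⟨q, fun U V h => ?_⟩
    simp only [termPerturbation_act,
      fiber_code_eq _ (plaqFamily_code_injective f a₀ lam hf hfconj hfosc hlam hflip hL), sum_singleton]
    exact (plaqFamily d L f a₀ lam hf hfconj hfosc hlam hflip q).dependsOn fun e he =>
      h e (wordEdges_plaqWord_subset q he)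
  · exfalso
    apply hX
    funext U
    simp only [termPerturbation_act, Pi.zero_apply]
    exact sum_eq_zero fun q hq => absurd ⟨q, (mem_fiber _).1 hq⟩ hfib

/-- **Membership** (landed, site-based incidence): `W_f ∈ ClusterDomainFR (2(d−1)a₀) (6 d (d−1) λ) 1`. [folklore] -/
theorem plaqFamily_mem_clusterDomainFR :
    termPerturbation (plaqFamily d L f a₀ lam hf hfconj hfosc hlam hflip) ∈
      ClusterDomainFR (2 * ((d : ℝ) - 1) * a₀) (6 * (d : ℝ) * ((d : ℝ) - 1) * lam) 1 := by
  refine termPerturbation_mem_clusterDomainFR (plaqFamily d L f a₀ lam hf hfconj hfosc hlam hflip)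
    (fun q => polymerDiam_plaqCode_le q.2.2.ne) (fun e => ?_)
    (fun e => sum_site_plaqFamily_le f a₀ lam hf hfconj hfosc hlam hflip e)
  simp only [plaqFamily_oscC, plaqFamily_letters]
  rw [← mul_sum, sum_mult_plaqFamily_real]
  exact le_of_eq (by ring)

/-- **Vertical dependence diameter `1`** of the member (`3 ≤ L`). [folklore] -/
theorem hasVertRange_plaqFamily (hL : 3 ≤ L) :
    HasVertRange 1 (termPerturbation (plaqFamily d L f a₀ lam hf hfconj hfosc hlam hflip)) :=
  hasVertRange_termPerturbation _ (plaqFamily_code_injective f a₀ lam hf hfconj hfosc hlam hflip hL) fun q v =>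
    window_plaqWord q.2.2.ne v

/-- **Slab-locality** of the member: centre-slab invariant (balanced plaquette words) with vertical dependence
diameter `1` (`3 ≤ L`). [folklore] -/
theorem isSlabLocal_plaqFamily (hL : 3 ≤ L) :
    IsSlabLocal 1 (termPerturbation (plaqFamily d L f a₀ lam hf hfconj hfosc hlam hflip)) :=
  isSlabLocal_termPerturbation _
    (fun q v t _z hz U => classActivity_centerSlabRotate f (netCount_plaqWord q.2.2.ne) v t hz U)
    (plaqFamily_code_injective f a₀ lam hf hfconj hfosc hlam hflip hL) fun q v => window_plaqWord q.2.2.ne v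

end Member

/-! ### The target -/

/-- **All-`N` form with the explicit hypothesis `0 ≤ λ`** (the body of `PlaquetteMemberTargetC` verbatim; for
`N ≤ 1` this hypothesis is NOT implied by the Lipschitz bound, see the module docstring): the plaquette action
`Σ_q f(U_q)` is a member `W_f` with `IsPlaquetteAction f W_f`, `IsPlaquetteLocal W_f`,
`W_f ∈ ClusterDomainFR (2(d−1)a₀) (6d(d−1)λ) 1`, `HasVertRange 1 W_f`, `IsSlabLocal 1 W_f`. [folklore] -/
theorem exists_plaquetteMember (N d : ℕ) (f : SUN N → ℝ) (a₀ lam : ℝ) (hf : Continuous f)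
    (hfconj : ∀ g h : SUN N, f (h * g * h⁻¹) = f g) (hfosc : ∀ x y, f x - f y ≤ a₀) (hlam : 0 ≤ lam)
    (hflip : ∀ x y, |f x - f y| ≤ lam * suFrobDist x y) (L : ℕ) [NeZero L] (hL : 3 ≤ L) :
    ∃ W : Perturbation d L N, IsPlaquetteAction f W ∧ IsPlaquetteLocal W ∧
      W ∈ ClusterDomainFR (2 * ((d : ℝ) - 1) * a₀) (6 * (d : ℝ) * ((d : ℝ) - 1) * lam) 1 ∧
        HasVertRange 1 W ∧ IsSlabLocal 1 W :=
  ⟨termPerturbation (plaqFamily d L f a₀ lam hf hfconj hfosc hlam hflip),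
    isPlaquetteAction_plaqFamily f a₀ lam hf hfconj hfosc hlam hflip,
    isPlaquetteLocal_plaqFamily f a₀ lam hf hfconj hfosc hlam hflip hL,
    plaqFamily_mem_clusterDomainFR f a₀ lam hf hfconj hfosc hlam hflip,
    hasVertRange_plaqFamily f a₀ lam hf hfconj hfosc hlam hflip hL,
    isSlabLocal_plaqFamily f a₀ lam hf hfconj hfosc hlam hflip hL⟩

/-- **THE PLAQUETTE RUNG IS INSIDE THE BALL — `PlaquetteMemberTargetC N d` holds for every `N ≥ 2` and every `d`**
(rb-theory's typed target, landed site-incidence numbers): for every continuous class function `f` on `SU(N)` with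
`f x − f y ≤ a₀` and `|f x − f y| ≤ λ‖x − y‖_F`, and every torus `L ≥ 3`, the plaquette action `Σ_q f(U_q)` is a member
`W_f` of rb-theory's carrier with `IsPlaquetteAction f W_f`, `IsPlaquetteLocal W_f`,
`W_f ∈ ClusterDomainFR (2(d−1)a₀) (6d(d−1)λ) 1`, `HasVertRange 1 W_f`, `IsSlabLocal 1 W_f`.  (`N ≥ 2` makes `λ ≥ 0`
a consequence of the Lipschitz hypothesis; see the module docstring for the idle corner `N ≤ 1`.) [folklore] -/
theorem plaquetteMemberTargetC_holds (N d : ℕ) (hN : 2 ≤ N) : PlaquetteMemberTargetC N d :=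
  fun f a₀ lam hf hfconj hfosc hflip L _ hL =>
    exists_plaquetteMember N d f a₀ lam hf hfconj hfosc (lipschitz_const_nonneg hN hflip) hflip L hL

/-- `SU(1)` is a point: every element is `1`. [folklore] -/
theorem sun_one_eq_one (x : SUN 1) : x = 1 := by
  apply Subtype.ext
  have hdet : (x : Matrix (Fin 1) (Fin 1) ℂ).det = 1 := (Matrix.mem_specialUnitaryGroup_iff.1 x.2).2
  rw [Matrix.det_fin_one] at hdet
  ext i j
  fin_cases i; fin_cases j
  simpa using hdet

/-- **The as-typed corner is false**: `¬ PlaquetteMemberTargetC 1 2`.  On `SU(1)` (a point) the Lipschitz hypothesis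
is idle, so `f = 0, a₀ = 0, λ = −1` is an admissible input; the required membership
`W ∈ ClusterDomainFR 0 (6·2·1·(−1)) 1` asks for a load witness with `ℓ_s(e) + Λ(e) ≤ −12` at the link
`e = (0, e₀)` of the `3`-torus, impossible since every witness has nonnegative Lipschitz entries.  (The physical
range `N ≥ 2` is covered by `plaquetteMemberTargetC_holds`; an all-`N` target needs the extra hypothesis `0 ≤ λ`,
discharged by `exists_plaquetteMember`.) [folklore] -/
theorem not_plaquetteMemberTargetC_one_two : ¬ PlaquetteMemberTargetC 1 2 := by
  intro h
  have hflip : ∀ x y : SUN 1, |(fun _ : SUN 1 => (0 : ℝ)) x - (fun _ : SUN 1 => (0 : ℝ)) y| ≤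
      (-1) * suFrobDist x y := fun x y => by
    rw [sun_one_eq_one x, sun_one_eq_one y, suFrobDist_self]; simp
  obtain ⟨W, -, -, hmem, -, -⟩ :=
    h (fun _ => 0) 0 (-1) continuous_const (fun _ _ => rfl) (fun _ _ => by simp) hflip 3 le_rfl
  obtain ⟨-, w, -, h₁⟩ := hmem
  have h₁' := h₁ ((fun _ => 0, 0) : Edge 2 3)
  have hs : 0 ≤ w.selfLipLoad 0 ((fun _ => 0, 0) : Edge 2 3) := by
    unfold LoadWitness.selfLipLoad
    exact sum_nonneg fun X _ => mul_nonneg (Real.exp_pos _).le ((w.lip_spec X).1 _)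
  have hc : 0 ≤ w.crossLipLoad 0 ((fun _ => 0, 0) : Edge 2 3) := by
    unfold LoadWitness.crossLipLoad LoadWitness.crossLip
    exact sum_nonneg fun y _ => sum_nonneg fun X _ => mul_nonneg (Real.exp_pos _).le ((w.lip_spec X).1 _)
  norm_num at h₁'
  linarith

/-- `SU(2)` instance of the plaquette-rung membership. [folklore] -/
theorem plaquetteMemberTargetC_su2 (d : ℕ) : PlaquetteMemberTargetC 2 d := plaquetteMemberTargetC_holds 2 d le_rfl

/-- `SU(3)` instance of the plaquette-rung membership. [folklore] -/
theorem plaquetteMemberTargetC_su3 (d : ℕ) : PlaquetteMemberTargetC 3 d :=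
  plaquetteMemberTargetC_holds 3 d (by norm_num)

end Summit.Ventures.YMGap.RobustBall

end
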